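import Summits.CriticalPhenomena.PercolationContinuityZ3.Theorems.PercNearOneGluingNoHeavyLowerTailSunflowerMultiPetalKempeMarkedLemmaB
import Summits.CriticalPhenomena.PercolationContinuityZ3.Theorems.PercNearOneGluingNoHeavyLowerTailSunflowerMultiPetalKempeMarkedFree
import HarnessLib
import HarnessLib.Audit

/-!
# `NoHeavyLowerTail` (crux stmt-CriticalPhenomena-4575), Lemma B for marked multigraphs: the TWO-TERMINAL FUNCTIONAL IS A SECOND DIFFERENCE —
# `18·T(K;u,v) = 3·Q(K⁺ᵘ) + 3·Q(K⁺ᵛ) − 2·Q((K/uv)⁺)`, hence (C*) `T ≥ 0` is MIDPOINT CONCAVITY of `Q` under marked identification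

Support file (seat `prim-l12-p2` gen 50; `--supports stmt-CriticalPhenomena-4575`; companion of `…KempeMarked` (p594349: `MGraph`, `TfunM`, `QcolM`),
`…KempeMarkedContract` (p596768: `contractOne`, `addAtU`), `…KempeMarkedFree` (p607944: `addMark`, `ctypeM_addMark`, colour permutations, free-vertex pinning)
and `…KempeMarkedLemmaB` (p609343: `TfunM_nonneg`)).  No `sorry`; nothing is asserted about the crux.
Memo: run/shared/lean/prim/prim-l12/prim-l12-p2/FINDING-g50-HYPERGRAPH-LANDSCAPE.md §1.

WHAT.  For a marked multigraph `K` on `V` and `u ≠ v` write `K⁺ʷ = K.addMark w 1` (one extra singleton member at `w`) and `K/vu = K.contractOne v u`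
(`v` identified into `u`, realised on `V` with `v` free, so every `QcolM` of a contraction carries a factor `3`).  The two-terminal weight is BY DEFINITION
`fC t = lbW (t ⊕ e₀) + lbW (t ⊕ e₁)` (p414773), i.e. the Lemma-B weight after marking the `0`-coloured terminal plus the same after marking the `1`-coloured one.  Hence
* `TfunM_eq_pinned_add` : `T(K;u,v) = Qpin(K⁺ᵘ;u,v) + Qpin(K⁺ᵛ;u,v)`, where `Qpin(L;u,v) = Σ_{σ u = 0, σ v = 1} lbW (type_L σ)` is the two-terminal-pinned Lemma-B sum (written out; no new definition);
* `sum_pair_eq_pinned`, `sum_ne_eq_six_mul_pinned` : by colour symmetry the pinned sum is one sixth of the `u,v`-SEPARATED part `Σ_{σ u ≠ σ v} lbW` of `Q(L)`;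
* `QcolM_contractOne_eq` : the non-separated part is one third of `Q(L/vu)` (the type of `L/vu` at `ρ` is the type of `L` at `ρ[v ↦ ρ u]`, and `v` is free);
* `eighteen_mul_pinned` : `18·Qpin(L;u,v) = 3·Q(L) − Q(L/vu)` — the pinned sum IS the identification defect `Q(L) − Q(L/uv)` of the vertex-identification
  conjecture CN (p392883), up to the factor `3` of the free vertex;
* `eighteen_mul_TfunM` (**the identity**): `18·T(K;u,v) = 3·Q(K⁺ᵘ) + 3·Q(K⁺ᵛ) − 2·Q((K/vu)⁺ᵘ)` (the three marked contractions `(K⁺ᵘ)/vu`, `(K⁺ᵛ)/vu`,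
  `(K/vu)⁺ᵘ` have the same type function, `ctypeM_addMark_contractOne_*`);
* `QcolM_contract_addMark_le` (**COROLLARY of (C*)**, p609343): `2·Q((K/vu)⁺ᵘ) ≤ 3·(Q(K⁺ᵘ) + Q(K⁺ᵛ))` for EVERY marked multigraph and all `u ≠ v` —
  dividing by the free-vertex factor, `Q` of the marked identification is at most the AVERAGE of the two singly-marked graphs ("midpoint concavity").
So the kernel-checked two-terminal inequality (C*) and the open identification conjecture CN are two statements about the same second difference:
CN(u,v) for `L` reads `Q(L/vu) ≤ 3·Q(L)`, and (C*) reads `CN` ON AVERAGE over the two singly-marked graphs `K⁺ᵘ`, `K⁺ᵛ` with the common contraction.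
These identities hold verbatim for arbitrary set families (memo §1, where they organise the hypergraph programme); this file is the marked-multigraph layer.
-/

namespace Summit.CriticalPhenomena.PercolationContinuityZ3.Theorems.SunflowerPartition.Kempe

open Finset

/-! ## Finite checks -/

/-- The part carried by a `0`-coloured vertex with one mark is `e₀`. (finite check) [this work] -/
theorem xPart_zero_mark : xPart 0 (cap3 1, cap3 1, cap3 1) = (1, 0, 0) := by decide

/-- The part carried by a `1`-coloured vertex with one mark is `e₁`. (finite check) [this work] -/
theorem xPart_one_mark : xPart 1 (cap3 1, cap3 1, cap3 1) = (0, 1, 0) := by decide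

/-- There are six ordered pairs of distinct colours. (finite check) [this work] -/
theorem card_colourPairs_ne : ((univ : Finset (Fin 3 × Fin 3)).filter fun p => p.1 ≠ p.2).card = 6 := by decide

namespace MGraph

variable {V : Type*} [Fintype V] [LinearOrder V] (K : MGraph V)

/-! ## The two-terminal-pinned Lemma-B sum -/

/-- **`T = Qpin(K⁺ᵘ) + Qpin(K⁺ᵛ)`**: the two-terminal functional is the pinned Lemma-B sum of the graph marked once at `u` plus that of the graph
marked once at `v` (pointwise: `fC t = lbW (t ⊕ e₀) + lbW (t ⊕ e₁)` is the definition of `fC`). [this work] -/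
theorem TfunM_eq_pinned_add (u v : V) :
    K.TfunM u v = (∑ σ ∈ univ.filter (fun σ : V → Fin 3 => σ u = 0 ∧ σ v = 1), lbW ((K.addMark u 1).ctypeM σ))
      + (∑ σ ∈ univ.filter (fun σ : V → Fin 3 => σ u = 0 ∧ σ v = 1), lbW ((K.addMark v 1).ctypeM σ)) := by
  unfold TfunM
  rw [← sum_add_distrib]
  refine sum_congr rfl fun σ hσ => ?_
  rw [mem_filter] at hσ
  rw [K.ctypeM_addMark u 1 σ, K.ctypeM_addMark v 1 σ, hσ.2.1, hσ.2.2, xPart_zero_mark, xPart_one_mark]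
  rfl

/-! ## Colour symmetry: every off-diagonal colour pair gives the same pinned sum -/

/-- For distinct colours `a ≠ b`, `Σ_{σ u = a, σ v = b} lbW (type σ) = Qpin(K;u,v)` (recolour by a colour permutation taking `0 ↦ a`, `1 ↦ b`;
`lbW` is permutation invariant). [this work] -/
theorem sum_pair_eq_pinned (u v : V) (a b : Fin 3) (hab : a ≠ b) :
    ∑ σ ∈ univ.filter (fun σ : V → Fin 3 => σ u = a ∧ σ v = b), lbW (K.ctypeM σ) = (∑ σ ∈ univ.filter (fun σ : V → Fin 3 => σ u = 0 ∧ σ v = 1), lbW (K.ctypeM σ)) := by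
  obtain ⟨ψ, π, h0, h1, hπψ, hψπ⟩ := exists_colourPerm a b hab
  have hπinj : ∀ c d, π c = π d → c = d := fun c d h => by rw [← hψπ c, ← hψπ d, h]
  symm
  refine sum_nbij' (fun σ w => ψ (σ w)) (fun σ w => π (σ w)) (fun σ hσ => ?_) (fun σ hσ => ?_)
    (fun σ _ => funext fun w => hπψ (σ w)) (fun σ _ => funext fun w => hψπ (σ w)) (fun σ _ => ?_)
  · rw [mem_filter] at hσ ⊢
    refine ⟨mem_univ _, ?_, ?_⟩
    · show ψ (σ u) = a
      rw [hσ.2.1, h0]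
    · show ψ (σ v) = b
      rw [hσ.2.2, h1]
  · rw [mem_filter] at hσ ⊢
    refine ⟨mem_univ _, ?_, ?_⟩
    · show π (σ u) = 0
      rw [hσ.2.1, ← h0, hπψ]
    · show π (σ v) = 1
      rw [hσ.2.2, ← h1, hπψ]
  · rw [K.ctypeM_comp_perm ψ π hψπ hπψ σ, lbW_permCT π hπinj]

/-- **The separated part is six pinned sums**: `Σ_{σ u ≠ σ v} lbW (type σ) = 6·Qpin(K;u,v)`. [this work] -/
theorem sum_ne_eq_six_mul_pinned (u v : V) :
    ∑ σ ∈ univ.filter (fun σ : V → Fin 3 => σ u ≠ σ v), lbW (K.ctypeM σ) = 6 * (∑ σ ∈ univ.filter (fun σ : V → Fin 3 => σ u = 0 ∧ σ v = 1), lbW (K.ctypeM σ)) := by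
  set s := univ.filter (fun σ : V → Fin 3 => σ u ≠ σ v) with hs
  set t := (univ : Finset (Fin 3 × Fin 3)).filter (fun p => p.1 ≠ p.2) with ht
  have hmaps : ∀ σ ∈ s, (σ u, σ v) ∈ t := fun σ hσ => by
    rw [hs, mem_filter] at hσ
    rw [ht, mem_filter]
    exact ⟨mem_univ _, hσ.2⟩
  rw [← sum_fiberwise_of_maps_to hmaps]
  have hfib : ∀ p ∈ t, ∑ σ ∈ s with (σ u, σ v) = p, lbW (K.ctypeM σ) = (∑ σ ∈ univ.filter (fun σ : V → Fin 3 => σ u = 0 ∧ σ v = 1), lbW (K.ctypeM σ)) := by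
    intro p hp
    rw [ht, mem_filter] at hp
    have hset : (s.filter fun σ => (σ u, σ v) = p) = univ.filter (fun σ : V → Fin 3 => σ u = p.1 ∧ σ v = p.2) := by
      ext σ
      simp only [hs, mem_filter, mem_univ, true_and, Prod.ext_iff]
      constructor
      · rintro ⟨_, h1, h2⟩; exact ⟨h1, h2⟩
      · rintro ⟨h1, h2⟩; exact ⟨by rw [h1, h2]; exact hp.2, h1, h2⟩
    rw [hset]
    exact K.sum_pair_eq_pinned u v p.1 p.2 hp.2
  rw [sum_congr rfl hfib, sum_const, card_colourPairs_ne]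
  simp

/-! ## The non-separated part is the contraction -/

omit [Fintype V] in
/-- The contracted vertex of `contractOne` is free. [this work] -/
theorem isFree_contractOne (s u : V) (hsu : s ≠ u) : (K.contractOne s u).IsFree s := by
  constructor
  · intro w
    unfold contractOne addAtU isolate
    simp [hsu]
  · unfold contractOne addAtU isolate
    simp [hsu]

/-- Type of a single-vertex contraction at any colouring: the type of `K` with `s` recoloured like `u` (type form of `cntM_contractOne`). [this work] -/
theorem ctypeM_contractOne_update (s u : V) (hsu : s ≠ u) (ρ : V → Fin 3) :
    (K.contractOne s u).ctypeM ρ = K.ctypeM (Function.update ρ s (ρ u)) := by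
  unfold ctypeM
  rw [K.cntM_contractOne s u hsu ρ 0, K.cntM_contractOne s u hsu ρ 1, K.cntM_contractOne s u hsu ρ 2]

/-- **`Q(K/vu) = 3·Σ_{σ u = σ v} lbW (type_K σ)`**: the Lemma-B functional of the contraction of `v` into `u` (on `V`, `v` free) is three times the
NON-separated part of `Q(K)`. [this work] -/
theorem QcolM_contractOne_eq (u v : V) (huv : u ≠ v) :
    (K.contractOne v u).QcolM = 3 * ∑ σ ∈ univ.filter (fun σ : V → Fin 3 => σ u = σ v), lbW (K.ctypeM σ) := by
  have hfree := K.isFree_contractOne v u huv.symm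
  have h3 := sum_filter_eq_three_mul (V := V) v (fun _ : V → Fin 3 => True) (fun _ _ => Iff.rfl)
    (fun ρ => lbW ((K.contractOne v u).ctypeM ρ)) (fun ρ c => by rw [(K.contractOne v u).ctypeM_update_of_isFree hfree ρ c])
    (fun ρ => ρ u) (fun ρ c => by rw [Function.update_of_ne huv])
  have hl : (univ.filter fun _ : V → Fin 3 => True) = (univ : Finset (V → Fin 3)) := by
    ext σ; simp
  rw [hl] at h3
  unfold QcolM
  rw [h3]
  congr 1
  have hset : (univ.filter fun σ : V → Fin 3 => True ∧ σ v = σ u) = univ.filter (fun σ : V → Fin 3 => σ u = σ v) := by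
    ext σ
    simp only [mem_filter, mem_univ, true_and]
    exact ⟨fun h => h.symm, fun h => h.symm⟩
  rw [hset]
  refine sum_congr rfl fun σ hσ => ?_
  rw [mem_filter] at hσ
  rw [K.ctypeM_contractOne_update v u huv.symm σ, hσ.2, Function.update_eq_self]

/-- **THE PINNED SUM IS THE IDENTIFICATION DEFECT**: `18·Qpin(K;u,v) = 3·Q(K) − Q(K/vu)` for every marked multigraph and `u ≠ v`. [this work] -/
theorem eighteen_mul_pinned (u v : V) (huv : u ≠ v) :
    18 * (∑ σ ∈ univ.filter (fun σ : V → Fin 3 => σ u = 0 ∧ σ v = 1), lbW (K.ctypeM σ)) = 3 * K.QcolM - (K.contractOne v u).QcolM := by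
  have hsplit : K.QcolM = (∑ σ ∈ univ.filter (fun σ : V → Fin 3 => σ u = σ v), lbW (K.ctypeM σ))
      + ∑ σ ∈ univ.filter (fun σ : V → Fin 3 => ¬ σ u = σ v), lbW (K.ctypeM σ) := by
    unfold QcolM
    exact (sum_filter_add_sum_filter_not univ (fun σ : V → Fin 3 => σ u = σ v) _).symm
  have hne := K.sum_ne_eq_six_mul_pinned u v
  have hcon := K.QcolM_contractOne_eq u v huv
  have hne' : (∑ σ ∈ univ.filter (fun σ : V → Fin 3 => ¬ σ u = σ v), lbW (K.ctypeM σ)) = 6 * (∑ σ ∈ univ.filter (fun σ : V → Fin 3 => σ u = 0 ∧ σ v = 1), lbW (K.ctypeM σ)) := hne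
  linarith

/-! ## The three marked contractions have the same types -/

/-- Type of `(K⁺ᵘ)/vu`: the type of `K` at `ρ[v ↦ ρ u]` plus one mark read at the colour `ρ u`. [this work] -/
theorem ctypeM_addMark_contractOne_left (u v : V) (huv : u ≠ v) (ρ : V → Fin 3) :
    ((K.addMark u 1).contractOne v u).ctypeM ρ = ctAdd (K.ctypeM (Function.update ρ v (ρ u))) (xPart (ρ u) (cap3 1, cap3 1, cap3 1)) := by
  rw [(K.addMark u 1).ctypeM_contractOne_update v u huv.symm ρ, K.ctypeM_addMark u 1, Function.update_of_ne huv]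

/-- Type of `(K⁺ᵛ)/vu`: the same. [this work] -/
theorem ctypeM_addMark_contractOne_right (u v : V) (huv : u ≠ v) (ρ : V → Fin 3) :
    ((K.addMark v 1).contractOne v u).ctypeM ρ = ctAdd (K.ctypeM (Function.update ρ v (ρ u))) (xPart (ρ u) (cap3 1, cap3 1, cap3 1)) := by
  rw [(K.addMark v 1).ctypeM_contractOne_update v u huv.symm ρ, K.ctypeM_addMark v 1, Function.update_self]

/-- Type of `(K/vu)⁺ᵘ`: the same. [this work] -/
theorem ctypeM_contractOne_addMark (u v : V) (huv : u ≠ v) (ρ : V → Fin 3) :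
    ((K.contractOne v u).addMark u 1).ctypeM ρ = ctAdd (K.ctypeM (Function.update ρ v (ρ u))) (xPart (ρ u) (cap3 1, cap3 1, cap3 1)) := by
  rw [(K.contractOne v u).ctypeM_addMark u 1 ρ, K.ctypeM_contractOne_update v u huv.symm ρ]

/-- `Q((K⁺ᵘ)/vu) = Q((K/vu)⁺ᵘ)`. [this work] -/
theorem QcolM_addMark_contractOne_left (u v : V) (huv : u ≠ v) :
    ((K.addMark u 1).contractOne v u).QcolM = ((K.contractOne v u).addMark u 1).QcolM := by
  unfold QcolM
  refine sum_congr rfl fun ρ _ => ?_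
  rw [K.ctypeM_addMark_contractOne_left u v huv ρ, K.ctypeM_contractOne_addMark u v huv ρ]

/-- `Q((K⁺ᵛ)/vu) = Q((K/vu)⁺ᵘ)`. [this work] -/
theorem QcolM_addMark_contractOne_right (u v : V) (huv : u ≠ v) :
    ((K.addMark v 1).contractOne v u).QcolM = ((K.contractOne v u).addMark u 1).QcolM := by
  unfold QcolM
  refine sum_congr rfl fun ρ _ => ?_
  rw [K.ctypeM_addMark_contractOne_right u v huv ρ, K.ctypeM_contractOne_addMark u v huv ρ]

/-! ## The identity and the concavity corollary -/

/-- **THE TWO-TERMINAL FUNCTIONAL IS A SECOND DIFFERENCE**: for every marked multigraph `K` and `u ≠ v`,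
`18·T(K;u,v) = 3·Q(K⁺ᵘ) + 3·Q(K⁺ᵛ) − 2·Q((K/vu)⁺ᵘ)` (the contraction realised on `V` with `v` free, which accounts for one factor `3`). [this work] -/
theorem eighteen_mul_TfunM (u v : V) (huv : u ≠ v) :
    18 * K.TfunM u v = 3 * (K.addMark u 1).QcolM + 3 * (K.addMark v 1).QcolM - 2 * ((K.contractOne v u).addMark u 1).QcolM := by
  rw [K.TfunM_eq_pinned_add u v, mul_add, (K.addMark u 1).eighteen_mul_pinned u v huv, (K.addMark v 1).eighteen_mul_pinned u v huv,
    K.QcolM_addMark_contractOne_left u v huv, K.QcolM_addMark_contractOne_right u v huv]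
  ring

/-- **MIDPOINT CONCAVITY OF `Q` UNDER MARKED IDENTIFICATION** (corollary of the kernel-checked two-terminal inequality `TfunM_nonneg`, p609343):
`2·Q((K/vu)⁺ᵘ) ≤ 3·(Q(K⁺ᵘ) + Q(K⁺ᵛ))` for every marked multigraph `K` and `u ≠ v`; since `v` is free in the contraction, this says that `Q` of the marked
identification (on `V ∖ v`) is at most the average of `Q(K⁺ᵘ)` and `Q(K⁺ᵛ)`. [this work] -/
theorem QcolM_contract_addMark_le (u v : V) (huv : u ≠ v) :
    2 * ((K.contractOne v u).addMark u 1).QcolM ≤ 3 * ((K.addMark u 1).QcolM + (K.addMark v 1).QcolM) := by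
  have h1 := K.eighteen_mul_TfunM u v huv
  have h2 := K.TfunM_nonneg u v
  linarith

/-- **The identification defect with one marked terminal, summed over the two terminals, is nonnegative**:
`Q((K⁺ᵘ)/vu) + Q((K⁺ᵛ)/vu) ≤ 3·Q(K⁺ᵘ) + 3·Q(K⁺ᵛ)` — i.e. the vertex-identification inequality CN holds ON AVERAGE over `K⁺ᵘ` and `K⁺ᵛ`. [this work] -/
theorem QcolM_contractOne_addMark_sum_le (u v : V) (huv : u ≠ v) :
    ((K.addMark u 1).contractOne v u).QcolM + ((K.addMark v 1).contractOne v u).QcolM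
      ≤ 3 * (K.addMark u 1).QcolM + 3 * (K.addMark v 1).QcolM := by
  have h1 := K.QcolM_contract_addMark_le u v huv
  rw [K.QcolM_addMark_contractOne_left u v huv, K.QcolM_addMark_contractOne_right u v huv]
  linarith


/-! ## Adding an EDGE is the mark effect on the contraction (the member–mark identity for a member of size 2; gen 50 append) -/

/-- Member counts with one extra edge `u–v` (realised as `addAtU u 𝟙_v`): the edge is monochromatic of colour `c` iff both ends have colour `c`. [this work] -/
theorem cntM_addEdge (u v : V) (huv : u ≠ v) (σ : V → Fin 3) (c : Fin 3) :
    (K.addAtU u (fun w => if w = v then 1 else 0) (if_neg huv) 0).cntM σ c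
      = K.cntM σ c + (if σ u = c then (if σ v = σ u then 1 else 0) else 0) := by
  rw [K.cntM_addAtU]
  have hsum : (∑ w, if σ w = c then (if w = v then 1 else 0) else 0) = if σ v = c then 1 else 0 := by
    have hw : ∀ w : V, (if σ w = c then (if w = v then 1 else 0) else 0) = if v = w then (if σ w = c then 1 else 0) else 0 := by
      intro w
      by_cases hwv : w = v
      · subst hwv; simp
      · have : ¬ v = w := fun e => hwv e.symm
        simp [hwv, this]
    rw [sum_congr rfl (fun w _ => hw w), sum_ite_eq]
    simp
  rw [hsum]
  by_cases hu : σ u = c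
  · rw [if_pos hu, if_pos hu]
    by_cases hv : σ v = c
    · rw [if_pos hv, if_pos (hv.trans hu.symm)]
    · have : ¬ σ v = σ u := fun e => hv (e.trans hu)
      rw [if_neg hv, if_neg this]
  · rw [if_neg hu, if_neg hu]

/-- The edge-added graph has, at every colouring, the member counts of `K` with `[σ v = σ u]` marks at `u`. [this work] -/
theorem cntM_addEdge_eq_addMark (u v : V) (huv : u ≠ v) (σ : V → Fin 3) (c : Fin 3) :
    (K.addAtU u (fun w => if w = v then 1 else 0) (if_neg huv) 0).cntM σ c = (K.addMark u (if σ v = σ u then 1 else 0)).cntM σ c := by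
  rw [K.cntM_addEdge u v huv σ c, K.cntM_addMark]

/-- Type of the edge-added graph: the type of `K` plus the part of `[σ v = σ u]` marks carried by `u`. [this work] -/
theorem ctypeM_addEdge (u v : V) (huv : u ≠ v) (σ : V → Fin 3) :
    (K.addAtU u (fun w => if w = v then 1 else 0) (if_neg huv) 0).ctypeM σ
      = ctAdd (K.ctypeM σ) (xPart (σ u) (cap3 (if σ v = σ u then 1 else 0), cap3 (if σ v = σ u then 1 else 0), cap3 (if σ v = σ u then 1 else 0))) := by
  rw [← K.ctypeM_addMark u (if σ v = σ u then 1 else 0) σ]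
  unfold ctypeM
  rw [K.cntM_addEdge_eq_addMark u v huv σ 0, K.cntM_addEdge_eq_addMark u v huv σ 1, K.cntM_addEdge_eq_addMark u v huv σ 2]

/-- Adding the zero part changes no type. (finite check) [this work] -/
theorem ctAdd_xPart_zero : ∀ (t : CType) (c : Fin 3), ctAdd t (xPart c (cap3 0, cap3 0, cap3 0)) = t := by decide

/-- **ADDING AN EDGE = THE MARK EFFECT ON THE CONTRACTION** (the member–mark identity (MM) for a 2-member): for every marked multigraph `K` and `u ≠ v`,
`3·[Q(K + uv) − Q(K)] = Q((K/vu)⁺ᵘ) − Q(K/vu)` (the contraction realised on `V` with `v` free, whence the factor `3`).  With `eighteen_mul_TfunM` this expresses every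
quantity of the two-terminal calculus through `Q` of marked minors. [this work] -/
theorem three_mul_QcolM_addEdge_sub (u v : V) (huv : u ≠ v) :
    3 * ((K.addAtU u (fun w => if w = v then 1 else 0) (if_neg huv) 0).QcolM - K.QcolM)
      = ((K.contractOne v u).addMark u 1).QcolM - (K.contractOne v u).QcolM := by
  -- both sides are `3·Σ_{σ u = σ v} [lbW (t ⊕ xPart (σ u) 𝟙) − lbW t]`
  have hR1 : ((K.contractOne v u).addMark u 1).QcolM
      = 3 * ∑ σ ∈ univ.filter (fun σ : V → Fin 3 => σ u = σ v), lbW ((K.addMark u 1).ctypeM σ) := by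
    rw [← K.QcolM_addMark_contractOne_left u v huv, (K.addMark u 1).QcolM_contractOne_eq u v huv]
  have hR2 := K.QcolM_contractOne_eq u v huv
  have hL : (K.addAtU u (fun w => if w = v then 1 else 0) (if_neg huv) 0).QcolM - K.QcolM
      = ∑ σ ∈ univ.filter (fun σ : V → Fin 3 => σ u = σ v), (lbW ((K.addMark u 1).ctypeM σ) - lbW (K.ctypeM σ)) := by
    unfold QcolM
    rw [← sum_sub_distrib, ← sum_filter_add_sum_filter_not univ (fun σ : V → Fin 3 => σ u = σ v)]
    have hz : ∑ σ ∈ univ.filter (fun σ : V → Fin 3 => ¬ σ u = σ v),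
        (lbW ((K.addAtU u (fun w => if w = v then 1 else 0) (if_neg huv) 0).ctypeM σ) - lbW (K.ctypeM σ)) = 0 := by
      refine sum_eq_zero fun σ hσ => ?_
      rw [mem_filter] at hσ
      have hvu : ¬ σ v = σ u := fun e => hσ.2 e.symm
      rw [K.ctypeM_addEdge u v huv σ, if_neg hvu, ctAdd_xPart_zero, sub_self]
    rw [hz, add_zero]
    refine sum_congr rfl fun σ hσ => ?_
    rw [mem_filter] at hσ
    rw [K.ctypeM_addEdge u v huv σ, if_pos hσ.2.symm, K.ctypeM_addMark u 1 σ]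
  rw [hL, hR1, hR2, ← mul_sub, ← sum_sub_distrib]

end MGraph

end Summit.CriticalPhenomena.PercolationContinuityZ3.Theorems.SunflowerPartition.Kempe
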